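import Literature.MathematicalPhysics.PowerSystems.StructurePreservingDichotomy
import Literature.MathematicalPhysics.PowerSystems.NonuniformKuramotoDichotomy
import HarnessLib

/-!
# Homogeneous natural frequencies: GLOBAL frequency synchronization from every initial state, for
# every network (Dörfler–Bullo, *Automatica* 2014 survey, Theorem 5.1 (Phase synchronization),
# statement 1) «Global convergence») — all three model tiers of this topic

Topic `Literature/MathematicalPhysics/PowerSystems`. Records used unchanged: `NonuniformKuramoto n`,
`DroopNetwork n`, `ClassicalModel.LosslessSystem n 0`, `BergenHill n`. Everything below is PROVED
(no definition, no named fact, no new axiom).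

SOURCE (read on the page). F. Dörfler, F. Bullo, «Synchronization in complex networks of phase
oscillators: A survey», Automatica 50 (2014) [DorflerBullo2014] (held:
`lit read paper:doi-10-1016-j-automatica-2014-04-012`, p0015 L46–L75): **Theorem 5.1 (Phase
synchronization)** «Consider the coupled oscillator model (1) with a connected graph and with natural
frequencies `ω ∈ ℝⁿ`. The following statements are equivalent: (i) Homogeneity: there exists a
constant `ω₀` such that `ωᵢ = ω₀` for all `i`; (ii) Local phase sync … If the two equivalent cases
(i) and (ii) are true, the following statements hold: 1) Global convergence: For all initial angles
`θ(0) ∈ 𝕋ⁿ`, the frequencies `θ̇(t)` converge to `ω₀𝟙ₙ` and the phases `θ(t)` converge to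
`{θ ∈ 𝕋ⁿ | ∂U(θ)/∂θ = 0ₙ}`; 2) Almost global stability …» (model (1):
`θ̇ᵢ = ωᵢ − Σⱼ aᵢⱼ sin(θᵢ − θⱼ)`, p0001 L60–L61).

WHAT IS TYPED. Statement 1) in the vocabulary of this topic and for all three tiers, as a corollary
of the FRAME-CORRECT DICHOTOMIES already in the tree (alternative (a) «`Σᵢ|P̃ᵢ||θᵢ − θₖ| → ∞`» has
all weights `P̃ᵢ = 0` under homogeneity, so alternative (b) holds for EVERY motion):
* §1 `NonuniformKuramoto.tendsto_field_of_homogeneous` (zero phase shifts, `P` symmetric, `Dᵢ > 0`;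
  HOMOGENEITY = equal specific natural frequencies, `ωᵢ = Dᵢ·c` for one `c`): along EVERY motion
  every frequency `θ̇ᵢ(t) → c` (`= Σω/ΣD`) — the printed 1) with non-uniform time constants (for
  `Dᵢ = 1` literally `ωᵢ ≡ ω₀`); `DroopNetwork.tendsto_frequency_of_homogeneous` (droop inverters
  whose set-points are proportional to their droop coefficients, `Pᵢ* = Dᵢc` — e.g. ALL `Pᵢ* = 0`:
  every frequency deviation `→ c`, i.e. `→ 0` for the unloaded microgrid).
* §2 `ClassicalModel.LosslessSystem.tendsto_speed_of_homogeneous` (isolated lossless multimachine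
  network, `C` symmetric, `Mᵢ, Dᵢ > 0`, net powers proportional to dampings `Pᵢ = Dᵢc` — in
  particular the UNLOADED network `P = 0`): along EVERY motion every speed `ωᵢ(t) → c` and every
  electrical power `flowᵢ(θ(t)) → 0`; `tendsto_speed_zero_of_unloaded` (`P = 0`: every motion
  comes to rest in frequency from every state).
* §3 `BergenHill.tendsto_speed_of_homogeneous` (structure-preserving model, `b` symmetric, `Mᵢ ≥ 0`,
  `Dᵢ > 0`, `P⁰ᵢ = Dᵢc`): every bus frequency `→ ω₀ = c` and every nodal flow `→ 0`.
The graph need NOT be connected here (each alternative-(b) conclusion is componentwise); the phase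
statement is typed as «every mismatch / flow tends to `0`», i.e. `∇U(θ(t)) → 0` — the distance to
the critical SET is not typed (no isolation is claimed; locking onto ONE equilibrium needs the `hiso`
hypothesis of the `tendsto_syncFrame_of_cohesive` theorems or `n = 2`).

THREE COLUMNS. CERTIFIED: kernel theorems, hypothesis = proportionality of the injections to the
dampings (ONE rational identity per node for a typed network; the unloaded case needs nothing).
MODELLED: the three model classes. NOT CLAIMED: statement 2) (almost-global phase sync), rates,
anything for heterogeneous injections (★ #96 / ★ #93 / cutset rows).
-/

noncomputable section

open Real Set Filter Topology Metric Finset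

namespace Literature.MathematicalPhysics.PowerSystems

/-- A function that is identically zero does not tend to `+∞` (private helper). [folklore] -/
private theorem not_tendsto_const_zero_atTop : ¬ Tendsto (fun _ : ℝ => (0 : ℝ)) atTop atTop := by
  intro h
  obtain ⟨t, ht⟩ := (h.eventually_gt_atTop 0).exists
  exact lt_irrefl _ ht

/-! ### §1. First order: non-uniform Kuramoto oscillators / droop-controlled inverters -/

namespace NonuniformKuramoto

variable {n : ℕ} (K : NonuniformKuramoto n)

/-- **Survey Theorem 5.1 1), global frequency convergence under homogeneity** (zero phase shifts,
`P` symmetric, `Dᵢ > 0`, any `n`, any topology): if the specific natural frequencies agree,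
`ωᵢ = Dᵢ·c` for one constant `c`, then along EVERY motion every frequency converges, `θ̇ᵢ(t) → c`
(equivalently every coupling sum `Σⱼ Pᵢⱼ sin(θᵢ − θⱼ) → 0`: the phases approach the critical set of
the potential). Proof: in the frame-correct dichotomy
`tendsto_sum_abs_sub_atTop_or_tendsto_field_syncFreq` the diverging alternative carries the weights
`|ωᵢ − Dᵢ Σω/ΣD| = 0`. [cite: DorflerBullo2014, §5 Thm 5.1 statement 1) (p0015 L46–L75)] -/
theorem tendsto_field_of_homogeneous (hD : ∀ i, 0 < K.D i) (hP : ∀ i j, K.P i j = K.P j i)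
    (hφ : ∀ i j, K.φ i j = 0) {c : ℝ} (hω : ∀ i, K.ω i = K.D i * c) {θ : ℝ → Fin n → ℝ}
    (hθ : ∀ T : ℝ, ∀ t ∈ Icc 0 T, HasDerivWithinAt θ (K.field (θ t)) (Icc 0 T) t) (i : Fin n) :
    Tendsto (fun t => K.field (θ t) i) atTop (𝓝 c) := by
  haveI : Nonempty (Fin n) := ⟨i⟩
  have hDs : 0 < ∑ j, K.D j := Finset.sum_pos (fun j _ => hD j) Finset.univ_nonempty
  have hc : (∑ j, K.ω j) / ∑ j, K.D j = c := by
    rw [div_eq_iff hDs.ne', Finset.mul_sum]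
    exact Finset.sum_congr rfl fun j _ => by rw [hω j]; ring
  have hw : ∀ j, K.ω j - K.D j * ((∑ l, K.ω l) / ∑ l, K.D l) = 0 := fun j => by
    rw [hc, hω j]; ring
  rcases K.tendsto_sum_abs_sub_atTop_or_tendsto_field_syncFreq hD hP hφ hθ with ha | hb
  · exfalso
    have h := ha i
    simp only [hw, abs_zero, zero_mul, Finset.sum_const_zero] at h
    exact not_tendsto_const_zero_atTop h
  · rw [← hc]; exact hb i

end NonuniformKuramoto

namespace DroopNetwork

variable {n : ℕ} (N : DroopNetwork n)

/-- **Droop inverters with set-points proportional to their droop coefficients synchronize from EVERY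
state** (`Dᵢ > 0`, `|Y|` symmetric; `Pᵢ* = Dᵢ·c`, e.g. all `Pᵢ* = 0`): every frequency deviation
`(Pᵢ* − P_e,i(θ(t)))/Dᵢ → c`. [cite: DorflerBullo2014, §5 Thm 5.1 statement 1) (p0015 L46–L75); SimpsonporcoDorflerBullo2013, §3 Lemma 1] -/
theorem tendsto_frequency_of_homogeneous (hD : ∀ i, 0 < N.Dc i)
    (hY : ∀ i j, N.Yabs i j = N.Yabs j i) {c : ℝ} (hP : ∀ i, N.Pstar i = N.Dc i * c)
    {θ : ℝ → Fin n → ℝ}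
    (hθ : ∀ T : ℝ, ∀ t ∈ Icc 0 T, HasDerivWithinAt θ (N.toKuramoto.field (θ t)) (Icc 0 T) t)
    (i : Fin n) :
    Tendsto (fun t => (N.Pstar i - N.injection (θ t) i) / N.Dc i) atTop (𝓝 c) := by
  have h := N.toKuramoto.tendsto_field_of_homogeneous hD (N.toKuramoto_P_symm hY)
    (fun _ _ => rfl) (c := c) hP hθ i
  simpa only [N.toKuramoto_field] using h

end DroopNetwork

/-! ### §2. Second order: the isolated lossless multimachine network -/

namespace ClassicalModel.LosslessSystem

variable {n : ℕ} (S : LosslessSystem n 0)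

/-- **Global frequency synchronization of the isolated lossless network with injections proportional
to the dampings** (`C` symmetric, `Mᵢ, Dᵢ > 0`, `Pᵢ = Dᵢ·c`; any `n`, any topology): along EVERY
motion every speed `ωᵢ(t) → c` and every electrical power `flowᵢ(θ(t)) → 0` — the second-order
reading of survey Thm 5.1 1), by the frame-correct dichotomy
`tendsto_sum_abs_sub_atTop_or_quasistatic_syncFrame` whose diverging alternative has zero weights.
[cite: DorflerBullo2014, §5 Thm 5.1 statement 1) (p0015 L46–L75), §2 (second-order model (9) shares the synchronization problem); Chiang1995, §3 Thm 3.1] -/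
theorem tendsto_speed_of_homogeneous (hC : ∀ i j, S.C i j = S.C j i) (hM : ∀ i, 0 < S.M i)
    (hD : ∀ i, 0 < S.D i) {c : ℝ} (hP : ∀ i, S.P i = S.D i * c)
    {X : ℝ → (Fin n → ℝ) × (Fin n → ℝ)}
    (hX : ∀ T : ℝ, ∀ t ∈ Icc 0 T, HasDerivWithinAt X (S.field (X t)) (Icc 0 T) t) :
    (∀ i, Tendsto (fun t => (X t).2 i) atTop (𝓝 c)) ∧
      ∀ i, Tendsto (fun t => S.flow (X t).1 i) atTop (𝓝 0) := by
  rcases Nat.eq_zero_or_pos n with hn | hn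
  · subst hn
    exact ⟨fun i => i.elim0, fun i => i.elim0⟩
  haveI : Nonempty (Fin n) := ⟨⟨0, hn⟩⟩
  have hDs : 0 < ∑ j, S.D j := Finset.sum_pos (fun j _ => hD j) Finset.univ_nonempty
  have hc : (∑ j, S.P j) / ∑ j, S.D j = c := by
    rw [div_eq_iff hDs.ne', Finset.mul_sum]
    exact Finset.sum_congr rfl fun j _ => by rw [hP j]; ring
  have hw : ∀ j, S.P j - S.D j * ((∑ l, S.P l) / ∑ l, S.D l) = 0 := fun j => by
    rw [hc, hP j]; ring
  rcases S.tendsto_sum_abs_sub_atTop_or_quasistatic_syncFrame hC hM hD hX with ha | ⟨hω, hmis⟩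
  · exfalso
    have h := ha ⟨0, hn⟩
    simp only [hw, abs_zero, zero_mul, Finset.sum_const_zero] at h
    exact not_tendsto_const_zero_atTop h
  · refine ⟨fun i => by rw [← hc]; exact hω i, fun i => ?_⟩
    have h := hmis i
    rw [hw i] at h
    have h2 := h.neg
    simp only [neg_sub, sub_zero, neg_zero] at h2
    exact h2

/-- **The unloaded isolated network comes to rest in frequency from EVERY state**: `P = 0`,
`C` symmetric, `Mᵢ, Dᵢ > 0` ⇒ every speed `ωᵢ(t) → 0` and every electrical power `flowᵢ(θ(t)) → 0`
along every motion (a network of damped pendula coupled by springs: no sustained oscillation, no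
rotation, whatever the initial state). [cite: DorflerBullo2014, §5 Thm 5.1 statement 1) (p0015 L46–L75); Leonov2001, Ch. 4 §4.2 Thm 4.1] -/
theorem tendsto_speed_zero_of_unloaded (hC : ∀ i j, S.C i j = S.C j i) (hM : ∀ i, 0 < S.M i)
    (hD : ∀ i, 0 < S.D i) (hP : ∀ i, S.P i = 0) {X : ℝ → (Fin n → ℝ) × (Fin n → ℝ)}
    (hX : ∀ T : ℝ, ∀ t ∈ Icc 0 T, HasDerivWithinAt X (S.field (X t)) (Icc 0 T) t) :
    (∀ i, Tendsto (fun t => (X t).2 i) atTop (𝓝 0)) ∧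
      ∀ i, Tendsto (fun t => S.flow (X t).1 i) atTop (𝓝 0) :=
  S.tendsto_speed_of_homogeneous hC hM hD (c := 0) (fun i => by rw [hP i, mul_zero]) hX

end ClassicalModel.LosslessSystem

/-! ### §3. The structure-preserving model -/

namespace BergenHill

variable {n : ℕ} (S : BergenHill n)

/-- **Structure-preserving model with injections proportional to the frequency coefficients**
(`b` symmetric, `Mᵢ ≥ 0`, `Dᵢ > 0`, `P⁰ᵢ = Dᵢ·c` at every bus — e.g. `P⁰ = 0`): along EVERY solution
every bus frequency — generator rotors AND load buses — tends to `c` (`= ω₀ = ΣP⁰/ΣD`) and every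
nodal flow `Σⱼ bᵢⱼ sin(δᵢ − δⱼ) → 0`. [cite: DorflerBullo2014, §5 Thm 5.1 statement 1) (p0015 L46–L75), §2 (structure-preserving model (9)); Padiyar2013, §3.2 eq. (3.5)] -/
theorem tendsto_speed_of_homogeneous (hb : ∀ i j, S.b i j = S.b j i) (hM : ∀ i, 0 ≤ S.M i)
    (hD : ∀ i, 0 < S.D i) {c : ℝ} (hP : ∀ i, S.P0 i = S.D i * c) {δ v : ℝ → Fin n → ℝ}
    (hsol : ∀ t, 0 ≤ t → S.IsSolutionAt δ v t) :
    (∀ i, Tendsto (fun t => v t i) atTop (𝓝 c)) ∧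
      ∀ i, Tendsto (fun t => S.flow (δ t) i) atTop (𝓝 0) := by
  rcases Nat.eq_zero_or_pos n with hn | hn
  · subst hn
    exact ⟨fun i => i.elim0, fun i => i.elim0⟩
  haveI : Nonempty (Fin n) := ⟨⟨0, hn⟩⟩
  have hDs : 0 < ∑ j, S.D j := Finset.sum_pos (fun j _ => hD j) Finset.univ_nonempty
  have hc : S.syncFrequency = c := by
    unfold syncFrequency
    rw [div_eq_iff hDs.ne', Finset.mul_sum]
    exact Finset.sum_congr rfl fun j _ => by rw [hP j]; ring
  have hw : ∀ j, S.shiftedInjection j = 0 := fun j => by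
    unfold shiftedInjection
    rw [hc, hP j]; ring
  rcases S.tendsto_sum_abs_sub_atTop_or_quasistatic_syncFrame hb hM hD hsol with ha | ⟨hω, hmis⟩
  · exfalso
    have h := ha ⟨0, hn⟩
    simp only [hw, abs_zero, zero_mul, Finset.sum_const_zero] at h
    exact not_tendsto_const_zero_atTop h
  · refine ⟨fun i => by rw [← hc]; exact hω i, fun i => ?_⟩
    have h := hmis i
    rw [hw i] at h
    have h2 := h.neg
    simp only [neg_sub, sub_zero, neg_zero] at h2
    exact h2

end BergenHill

end Literature.MathematicalPhysics.PowerSystems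

end
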